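import Mathlib
import HarnessLib
import Literature.Geometry.DiscreteGeometry.KissingPatterns

/-!
# Bond stars of the FCC and HCP kissing patterns: the integer tables (crux `SoftLayerPropagation`, line `Sketch`)

Route `PricedLinkCensus`, crux `SoftLayerPropagation` (stmt-AtomisticToContinuum-14233), line
`Sketch`, helper file for the stub `stub_shadow` (development of the exact shadow crystal): the
purely combinatorial facts about the two kissing patterns that the TRANSITION LEMMA between the
charts of two bonded sites consumes (`…StubShadowTransition.lean`), packaged as the registered
sub-goal `shadow_starTables`.

Work in the integer models `fccInt` (squared norm `N = 2`) and `hcpInt` (`N = 18`); `v ~ w` means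
`|v − w|² = N` (pattern contact).  Fix a pattern point `v₀` (the label of the bonded site) and its
four contacts `q` (the labels of the four common neighbours = the BOND STAR).  Two distinct
non-adjacent contacts `q, q'` of `v₀` are at squared distance `2N`, `3N` or `8N/3`, and WHICH ONE is
decided by the contact graph of the star together with ONE bit of orientation:

* (α) `q, q'` have a common contact `r` in the star ⟹ `|q − q'|² = 8N/3` (the two caps of an
  equatorial HCP star);
* (β) `q'` has a contact `r₁ ≁ q` and there is a further star point `r₂ ∉ {q, q'}` with
  `r₂ ~ r₁`, `r₂ ≁ q, q'` ⟹ `2N` (the lone vertex against a cap of an equatorial HCP star);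
* (γ) `q'` has two contacts `r₁ ≠ r₂`, both `≁ q` ⟹ `3N` (lone vertex against the middle vertex);
* (δ) `q ~ r₁`, `q' ~ r₂`, `r₁ ≠ r₂`, no other contacts among the four (the star of an FCC bond or
  of an HCP cap bond: two disjoint contact edges) ⟹ the two edges are PARALLEL, and
  `q − r₁ = q' − r₂` forces `2N` (a square diagonal) while `q − r₁ = r₂ − q'` forces `3N`;

and (exhaustion) one of these witnesses always exists; finally every `v₀` has two contacts in
contact (a contact triangle through `v₀`, used as a frame).  Everything is a `decide` over the two
twelve-element tables; the quantifiers are interleaved with their guards so that the decision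
procedure only visits genuine stars.  The numeral `N` is written as a cast natural number so that
the tables instantiate the pattern-generic transition lemma verbatim.  All `[folklore]`
(elementary geometry of the cuboctahedron and the anticuboctahedron, cf. HalesDSP2012 §1.3).
-/

namespace Summit.AtomisticToContinuum.Crystallization.Theorems

open Literature.Geometry.DiscreteGeometry

set_option maxRecDepth 8000
set_option synthInstance.maxSize 8192
set_option synthInstance.maxHeartbeats 800000

/-! ### FCC (`N = 2`) -/

/-- FCC: every point `v₀` of the pattern has two contacts in contact (a contact triangle through
`v₀`). [folklore] -/
theorem fccInt_star_edge : ∀ v₀ ∈ fccInt, ∃ a ∈ fccInt, ∃ b ∈ fccInt,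
    sqNormInt (v₀ - a) = (2 : ℕ) ∧ sqNormInt (v₀ - b) = (2 : ℕ) ∧ sqNormInt (a - b) = (2 : ℕ) := by
  decide

/-- FCC, witness (α) ⟹ `8N/3`. [folklore] -/
theorem fccInt_star_alpha : ∀ v₀ ∈ fccInt, ∀ q ∈ fccInt, sqNormInt (v₀ - q) = (2 : ℕ) → ∀ q' ∈ fccInt,
    (sqNormInt (v₀ - q') = (2 : ℕ) ∧ q ≠ q' ∧ sqNormInt (q - q') ≠ (2 : ℕ)) →
    ∀ r ∈ fccInt, (sqNormInt (v₀ - r) = (2 : ℕ) ∧ sqNormInt (q - r) = (2 : ℕ) ∧ sqNormInt (q' - r) = (2 : ℕ)) →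
    3 * sqNormInt (q - q') = 8 * (2 : ℕ) := by
  decide

/-- FCC, witness (β) ⟹ `2N`. [folklore] -/
theorem fccInt_star_beta : ∀ v₀ ∈ fccInt, ∀ q ∈ fccInt, sqNormInt (v₀ - q) = (2 : ℕ) → ∀ q' ∈ fccInt,
    (sqNormInt (v₀ - q') = (2 : ℕ) ∧ q ≠ q' ∧ sqNormInt (q - q') ≠ (2 : ℕ)) →
    ∀ r₁ ∈ fccInt, (sqNormInt (v₀ - r₁) = (2 : ℕ) ∧ sqNormInt (q' - r₁) = (2 : ℕ) ∧ sqNormInt (q - r₁) ≠ (2 : ℕ)) →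
    ∀ r₂ ∈ fccInt, (sqNormInt (v₀ - r₂) = (2 : ℕ) ∧ r₂ ≠ q ∧ r₂ ≠ q' ∧ sqNormInt (q - r₂) ≠ (2 : ℕ) ∧
      sqNormInt (q' - r₂) ≠ (2 : ℕ) ∧ sqNormInt (r₁ - r₂) = (2 : ℕ)) →
    sqNormInt (q - q') = 2 * (2 : ℕ) := by
  decide

/-- FCC, witness (γ) ⟹ `3N`. [folklore] -/
theorem fccInt_star_gamma : ∀ v₀ ∈ fccInt, ∀ q ∈ fccInt, sqNormInt (v₀ - q) = (2 : ℕ) → ∀ q' ∈ fccInt,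
    (sqNormInt (v₀ - q') = (2 : ℕ) ∧ q ≠ q' ∧ sqNormInt (q - q') ≠ (2 : ℕ)) →
    ∀ r₁ ∈ fccInt, (sqNormInt (v₀ - r₁) = (2 : ℕ) ∧ sqNormInt (q' - r₁) = (2 : ℕ) ∧ sqNormInt (q - r₁) ≠ (2 : ℕ)) →
    ∀ r₂ ∈ fccInt, (sqNormInt (v₀ - r₂) = (2 : ℕ) ∧ r₁ ≠ r₂ ∧ sqNormInt (q' - r₂) = (2 : ℕ) ∧ sqNormInt (q - r₂) ≠ (2 : ℕ)) →
    sqNormInt (q - q') = 3 * (2 : ℕ) := by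
  decide

/-- FCC, witness (δ): two disjoint contact edges of a bond star are parallel, and the
orientation decides between a square diagonal (`2N`) and an opposite pair (`3N`). [folklore] -/
theorem fccInt_star_delta : ∀ v₀ ∈ fccInt, ∀ q ∈ fccInt, sqNormInt (v₀ - q) = (2 : ℕ) → ∀ q' ∈ fccInt,
    (sqNormInt (v₀ - q') = (2 : ℕ) ∧ q ≠ q' ∧ sqNormInt (q - q') ≠ (2 : ℕ)) →
    ∀ r₁ ∈ fccInt, (sqNormInt (v₀ - r₁) = (2 : ℕ) ∧ sqNormInt (q - r₁) = (2 : ℕ) ∧ sqNormInt (q' - r₁) ≠ (2 : ℕ)) →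
    ∀ r₂ ∈ fccInt, (sqNormInt (v₀ - r₂) = (2 : ℕ) ∧ r₁ ≠ r₂ ∧ sqNormInt (q' - r₂) = (2 : ℕ) ∧
      sqNormInt (r₁ - r₂) ≠ (2 : ℕ) ∧ sqNormInt (q - r₂) ≠ (2 : ℕ)) →
    (q - r₁ = q' - r₂ ∧ sqNormInt (q - q') = 2 * (2 : ℕ)) ∨
      (q - r₁ = r₂ - q' ∧ sqNormInt (q - q') = 3 * (2 : ℕ)) := by
  decide

/-- FCC, exhaustion: every pair of distinct non-adjacent contacts of `v₀` carries one of the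
witnesses (α), (β), (βᵗ), (γ), (γᵗ), (δ), together with the squared distance it forces.
[folklore] -/
theorem fccInt_star_cases : ∀ v₀ ∈ fccInt, ∀ q ∈ fccInt, sqNormInt (v₀ - q) = (2 : ℕ) → ∀ q' ∈ fccInt,
    (sqNormInt (v₀ - q') = (2 : ℕ) ∧ q ≠ q' ∧ sqNormInt (q - q') ≠ (2 : ℕ)) →
    (∃ r ∈ fccInt, sqNormInt (v₀ - r) = (2 : ℕ) ∧ sqNormInt (q - r) = (2 : ℕ) ∧ sqNormInt (q' - r) = (2 : ℕ) ∧
        3 * sqNormInt (q - q') = 8 * (2 : ℕ)) ∨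
    (∃ r₁ ∈ fccInt, ∃ r₂ ∈ fccInt, sqNormInt (v₀ - r₁) = (2 : ℕ) ∧ sqNormInt (v₀ - r₂) = (2 : ℕ) ∧
        sqNormInt (q' - r₁) = (2 : ℕ) ∧ sqNormInt (q - r₁) ≠ (2 : ℕ) ∧ r₂ ≠ q ∧ r₂ ≠ q' ∧
        sqNormInt (q - r₂) ≠ (2 : ℕ) ∧ sqNormInt (q' - r₂) ≠ (2 : ℕ) ∧ sqNormInt (r₁ - r₂) = (2 : ℕ) ∧
        sqNormInt (q - q') = 2 * (2 : ℕ)) ∨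
    (∃ r₁ ∈ fccInt, ∃ r₂ ∈ fccInt, sqNormInt (v₀ - r₁) = (2 : ℕ) ∧ sqNormInt (v₀ - r₂) = (2 : ℕ) ∧
        sqNormInt (q - r₁) = (2 : ℕ) ∧ sqNormInt (q' - r₁) ≠ (2 : ℕ) ∧ r₂ ≠ q' ∧ r₂ ≠ q ∧
        sqNormInt (q' - r₂) ≠ (2 : ℕ) ∧ sqNormInt (q - r₂) ≠ (2 : ℕ) ∧ sqNormInt (r₁ - r₂) = (2 : ℕ) ∧
        sqNormInt (q - q') = 2 * (2 : ℕ)) ∨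
    (∃ r₁ ∈ fccInt, ∃ r₂ ∈ fccInt, sqNormInt (v₀ - r₁) = (2 : ℕ) ∧ sqNormInt (v₀ - r₂) = (2 : ℕ) ∧ r₁ ≠ r₂ ∧
        sqNormInt (q' - r₁) = (2 : ℕ) ∧ sqNormInt (q' - r₂) = (2 : ℕ) ∧
        sqNormInt (q - r₁) ≠ (2 : ℕ) ∧ sqNormInt (q - r₂) ≠ (2 : ℕ) ∧ sqNormInt (q - q') = 3 * (2 : ℕ)) ∨
    (∃ r₁ ∈ fccInt, ∃ r₂ ∈ fccInt, sqNormInt (v₀ - r₁) = (2 : ℕ) ∧ sqNormInt (v₀ - r₂) = (2 : ℕ) ∧ r₁ ≠ r₂ ∧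
        sqNormInt (q - r₁) = (2 : ℕ) ∧ sqNormInt (q - r₂) = (2 : ℕ) ∧
        sqNormInt (q' - r₁) ≠ (2 : ℕ) ∧ sqNormInt (q' - r₂) ≠ (2 : ℕ) ∧ sqNormInt (q - q') = 3 * (2 : ℕ)) ∨
    (∃ r₁ ∈ fccInt, ∃ r₂ ∈ fccInt, sqNormInt (v₀ - r₁) = (2 : ℕ) ∧ sqNormInt (v₀ - r₂) = (2 : ℕ) ∧ r₁ ≠ r₂ ∧
        sqNormInt (q - r₁) = (2 : ℕ) ∧ sqNormInt (q' - r₂) = (2 : ℕ) ∧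
        sqNormInt (r₁ - r₂) ≠ (2 : ℕ) ∧ sqNormInt (q' - r₁) ≠ (2 : ℕ) ∧ sqNormInt (q - r₂) ≠ (2 : ℕ) ∧
        ((q - r₁ = q' - r₂ ∧ sqNormInt (q - q') = 2 * (2 : ℕ)) ∨
          (q - r₁ = r₂ - q' ∧ sqNormInt (q - q') = 3 * (2 : ℕ)))) := by
  decide

/-! ### HCP (`N = 18`) -/

/-- HCP: every point `v₀` of the pattern has two contacts in contact (a contact triangle through
`v₀`). [folklore] -/
theorem hcpInt_star_edge : ∀ v₀ ∈ hcpInt, ∃ a ∈ hcpInt, ∃ b ∈ hcpInt,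
    sqNormInt (v₀ - a) = (18 : ℕ) ∧ sqNormInt (v₀ - b) = (18 : ℕ) ∧ sqNormInt (a - b) = (18 : ℕ) := by
  decide

/-- HCP, witness (α) ⟹ `8N/3`. [folklore] -/
theorem hcpInt_star_alpha : ∀ v₀ ∈ hcpInt, ∀ q ∈ hcpInt, sqNormInt (v₀ - q) = (18 : ℕ) → ∀ q' ∈ hcpInt,
    (sqNormInt (v₀ - q') = (18 : ℕ) ∧ q ≠ q' ∧ sqNormInt (q - q') ≠ (18 : ℕ)) →
    ∀ r ∈ hcpInt, (sqNormInt (v₀ - r) = (18 : ℕ) ∧ sqNormInt (q - r) = (18 : ℕ) ∧ sqNormInt (q' - r) = (18 : ℕ)) →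
    3 * sqNormInt (q - q') = 8 * (18 : ℕ) := by
  decide

/-- HCP, witness (β) ⟹ `2N`. [folklore] -/
theorem hcpInt_star_beta : ∀ v₀ ∈ hcpInt, ∀ q ∈ hcpInt, sqNormInt (v₀ - q) = (18 : ℕ) → ∀ q' ∈ hcpInt,
    (sqNormInt (v₀ - q') = (18 : ℕ) ∧ q ≠ q' ∧ sqNormInt (q - q') ≠ (18 : ℕ)) →
    ∀ r₁ ∈ hcpInt, (sqNormInt (v₀ - r₁) = (18 : ℕ) ∧ sqNormInt (q' - r₁) = (18 : ℕ) ∧ sqNormInt (q - r₁) ≠ (18 : ℕ)) →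
    ∀ r₂ ∈ hcpInt, (sqNormInt (v₀ - r₂) = (18 : ℕ) ∧ r₂ ≠ q ∧ r₂ ≠ q' ∧ sqNormInt (q - r₂) ≠ (18 : ℕ) ∧
      sqNormInt (q' - r₂) ≠ (18 : ℕ) ∧ sqNormInt (r₁ - r₂) = (18 : ℕ)) →
    sqNormInt (q - q') = 2 * (18 : ℕ) := by
  decide

/-- HCP, witness (γ) ⟹ `3N`. [folklore] -/
theorem hcpInt_star_gamma : ∀ v₀ ∈ hcpInt, ∀ q ∈ hcpInt, sqNormInt (v₀ - q) = (18 : ℕ) → ∀ q' ∈ hcpInt,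
    (sqNormInt (v₀ - q') = (18 : ℕ) ∧ q ≠ q' ∧ sqNormInt (q - q') ≠ (18 : ℕ)) →
    ∀ r₁ ∈ hcpInt, (sqNormInt (v₀ - r₁) = (18 : ℕ) ∧ sqNormInt (q' - r₁) = (18 : ℕ) ∧ sqNormInt (q - r₁) ≠ (18 : ℕ)) →
    ∀ r₂ ∈ hcpInt, (sqNormInt (v₀ - r₂) = (18 : ℕ) ∧ r₁ ≠ r₂ ∧ sqNormInt (q' - r₂) = (18 : ℕ) ∧ sqNormInt (q - r₂) ≠ (18 : ℕ)) →
    sqNormInt (q - q') = 3 * (18 : ℕ) := by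
  decide

/-- HCP, witness (δ): two disjoint contact edges of a bond star are parallel, and the
orientation decides between a square diagonal (`2N`) and an opposite pair (`3N`). [folklore] -/
theorem hcpInt_star_delta : ∀ v₀ ∈ hcpInt, ∀ q ∈ hcpInt, sqNormInt (v₀ - q) = (18 : ℕ) → ∀ q' ∈ hcpInt,
    (sqNormInt (v₀ - q') = (18 : ℕ) ∧ q ≠ q' ∧ sqNormInt (q - q') ≠ (18 : ℕ)) →
    ∀ r₁ ∈ hcpInt, (sqNormInt (v₀ - r₁) = (18 : ℕ) ∧ sqNormInt (q - r₁) = (18 : ℕ) ∧ sqNormInt (q' - r₁) ≠ (18 : ℕ)) →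
    ∀ r₂ ∈ hcpInt, (sqNormInt (v₀ - r₂) = (18 : ℕ) ∧ r₁ ≠ r₂ ∧ sqNormInt (q' - r₂) = (18 : ℕ) ∧
      sqNormInt (r₁ - r₂) ≠ (18 : ℕ) ∧ sqNormInt (q - r₂) ≠ (18 : ℕ)) →
    (q - r₁ = q' - r₂ ∧ sqNormInt (q - q') = 2 * (18 : ℕ)) ∨
      (q - r₁ = r₂ - q' ∧ sqNormInt (q - q') = 3 * (18 : ℕ)) := by
  decide

/-- HCP, exhaustion: every pair of distinct non-adjacent contacts of `v₀` carries one of the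
witnesses (α), (β), (βᵗ), (γ), (γᵗ), (δ), together with the squared distance it forces.
[folklore] -/
theorem hcpInt_star_cases : ∀ v₀ ∈ hcpInt, ∀ q ∈ hcpInt, sqNormInt (v₀ - q) = (18 : ℕ) → ∀ q' ∈ hcpInt,
    (sqNormInt (v₀ - q') = (18 : ℕ) ∧ q ≠ q' ∧ sqNormInt (q - q') ≠ (18 : ℕ)) →
    (∃ r ∈ hcpInt, sqNormInt (v₀ - r) = (18 : ℕ) ∧ sqNormInt (q - r) = (18 : ℕ) ∧ sqNormInt (q' - r) = (18 : ℕ) ∧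
        3 * sqNormInt (q - q') = 8 * (18 : ℕ)) ∨
    (∃ r₁ ∈ hcpInt, ∃ r₂ ∈ hcpInt, sqNormInt (v₀ - r₁) = (18 : ℕ) ∧ sqNormInt (v₀ - r₂) = (18 : ℕ) ∧
        sqNormInt (q' - r₁) = (18 : ℕ) ∧ sqNormInt (q - r₁) ≠ (18 : ℕ) ∧ r₂ ≠ q ∧ r₂ ≠ q' ∧
        sqNormInt (q - r₂) ≠ (18 : ℕ) ∧ sqNormInt (q' - r₂) ≠ (18 : ℕ) ∧ sqNormInt (r₁ - r₂) = (18 : ℕ) ∧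
        sqNormInt (q - q') = 2 * (18 : ℕ)) ∨
    (∃ r₁ ∈ hcpInt, ∃ r₂ ∈ hcpInt, sqNormInt (v₀ - r₁) = (18 : ℕ) ∧ sqNormInt (v₀ - r₂) = (18 : ℕ) ∧
        sqNormInt (q - r₁) = (18 : ℕ) ∧ sqNormInt (q' - r₁) ≠ (18 : ℕ) ∧ r₂ ≠ q' ∧ r₂ ≠ q ∧
        sqNormInt (q' - r₂) ≠ (18 : ℕ) ∧ sqNormInt (q - r₂) ≠ (18 : ℕ) ∧ sqNormInt (r₁ - r₂) = (18 : ℕ) ∧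
        sqNormInt (q - q') = 2 * (18 : ℕ)) ∨
    (∃ r₁ ∈ hcpInt, ∃ r₂ ∈ hcpInt, sqNormInt (v₀ - r₁) = (18 : ℕ) ∧ sqNormInt (v₀ - r₂) = (18 : ℕ) ∧ r₁ ≠ r₂ ∧
        sqNormInt (q' - r₁) = (18 : ℕ) ∧ sqNormInt (q' - r₂) = (18 : ℕ) ∧
        sqNormInt (q - r₁) ≠ (18 : ℕ) ∧ sqNormInt (q - r₂) ≠ (18 : ℕ) ∧ sqNormInt (q - q') = 3 * (18 : ℕ)) ∨
    (∃ r₁ ∈ hcpInt, ∃ r₂ ∈ hcpInt, sqNormInt (v₀ - r₁) = (18 : ℕ) ∧ sqNormInt (v₀ - r₂) = (18 : ℕ) ∧ r₁ ≠ r₂ ∧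
        sqNormInt (q - r₁) = (18 : ℕ) ∧ sqNormInt (q - r₂) = (18 : ℕ) ∧
        sqNormInt (q' - r₁) ≠ (18 : ℕ) ∧ sqNormInt (q' - r₂) ≠ (18 : ℕ) ∧ sqNormInt (q - q') = 3 * (18 : ℕ)) ∨
    (∃ r₁ ∈ hcpInt, ∃ r₂ ∈ hcpInt, sqNormInt (v₀ - r₁) = (18 : ℕ) ∧ sqNormInt (v₀ - r₂) = (18 : ℕ) ∧ r₁ ≠ r₂ ∧
        sqNormInt (q - r₁) = (18 : ℕ) ∧ sqNormInt (q' - r₂) = (18 : ℕ) ∧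
        sqNormInt (r₁ - r₂) ≠ (18 : ℕ) ∧ sqNormInt (q' - r₁) ≠ (18 : ℕ) ∧ sqNormInt (q - r₂) ≠ (18 : ℕ) ∧
        ((q - r₁ = q' - r₂ ∧ sqNormInt (q - q') = 2 * (18 : ℕ)) ∨
          (q - r₁ = r₂ - q' ∧ sqNormInt (q - q') = 3 * (18 : ℕ)))) := by
  decide

/-! ### The package consumed by the transition lemma -/

/-- **Registered sub-goal `shadow_starTables`** of the crux item: each of the two kissing patterns
is the scaling `{v/√N : v ∈ S}` of an integer model `(S, N)` all of whose points have squared norm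
`N` and whose bond stars satisfy the six tables above (contact triangle through every point;
exhaustion of the witnesses (α)…(δ) with the squared distances they force; and the four
witness-to-distance rules). [folklore] -/
theorem shadow_starTables :  open Literature.Geometry.DiscreteGeometry in ∀ P : Finset
    (EuclideanSpace ℝ (Fin 3)), (P = fccKissingPattern ∨ P = hcpKissingPattern) → ∃ (S : Finset (Fin
    3 → ℤ)) (N : ℕ), N ≠ 0 ∧ (∀ v ∈ S, sqNormInt v = N) ∧ P = scaledPattern S N ∧ (∀ v₀ ∈ S, ∃ a ∈
    S, ∃ b ∈ S, sqNormInt (v₀ - a) = N ∧ sqNormInt (v₀ - b) = N ∧ sqNormInt (a - b) = N) ∧ (∀ v₀ ∈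
    S, ∀ q ∈ S, sqNormInt (v₀ - q) = N → ∀ q' ∈ S, (sqNormInt (v₀ - q') = N ∧ q ≠ q' ∧ sqNormInt (q
    - q') ≠ N) → (∃ r ∈ S, sqNormInt (v₀ - r) = N ∧ sqNormInt (q - r) = N ∧ sqNormInt (q' - r) = N ∧
    3 * sqNormInt (q - q') = 8 * N) ∨ (∃ r₁ ∈ S, ∃ r₂ ∈ S, sqNormInt (v₀ - r₁) = N ∧ sqNormInt (v₀ -
    r₂) = N ∧ sqNormInt (q' - r₁) = N ∧ sqNormInt (q - r₁) ≠ N ∧ r₂ ≠ q ∧ r₂ ≠ q' ∧ sqNormInt (q -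
    r₂) ≠ N ∧ sqNormInt (q' - r₂) ≠ N ∧ sqNormInt (r₁ - r₂) = N ∧ sqNormInt (q - q') = 2 * N) ∨ (∃
    r₁ ∈ S, ∃ r₂ ∈ S, sqNormInt (v₀ - r₁) = N ∧ sqNormInt (v₀ - r₂) = N ∧ sqNormInt (q - r₁) = N ∧
    sqNormInt (q' - r₁) ≠ N ∧ r₂ ≠ q' ∧ r₂ ≠ q ∧ sqNormInt (q' - r₂) ≠ N ∧ sqNormInt (q - r₂) ≠ N ∧
    sqNormInt (r₁ - r₂) = N ∧ sqNormInt (q - q') = 2 * N) ∨ (∃ r₁ ∈ S, ∃ r₂ ∈ S, sqNormInt (v₀ - r₁)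
    = N ∧ sqNormInt (v₀ - r₂) = N ∧ r₁ ≠ r₂ ∧ sqNormInt (q' - r₁) = N ∧ sqNormInt (q' - r₂) = N ∧
    sqNormInt (q - r₁) ≠ N ∧ sqNormInt (q - r₂) ≠ N ∧ sqNormInt (q - q') = 3 * N) ∨ (∃ r₁ ∈ S, ∃ r₂
    ∈ S, sqNormInt (v₀ - r₁) = N ∧ sqNormInt (v₀ - r₂) = N ∧ r₁ ≠ r₂ ∧ sqNormInt (q - r₁) = N ∧
    sqNormInt (q - r₂) = N ∧ sqNormInt (q' - r₁) ≠ N ∧ sqNormInt (q' - r₂) ≠ N ∧ sqNormInt (q - q')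
    = 3 * N) ∨ (∃ r₁ ∈ S, ∃ r₂ ∈ S, sqNormInt (v₀ - r₁) = N ∧ sqNormInt (v₀ - r₂) = N ∧ r₁ ≠ r₂ ∧
    sqNormInt (q - r₁) = N ∧ sqNormInt (q' - r₂) = N ∧ sqNormInt (r₁ - r₂) ≠ N ∧ sqNormInt (q' - r₁)
    ≠ N ∧ sqNormInt (q - r₂) ≠ N ∧ ((q - r₁ = q' - r₂ ∧ sqNormInt (q - q') = 2 * N) ∨ (q - r₁ = r₂ -
    q' ∧ sqNormInt (q - q') = 3 * N)))) ∧ (∀ v₀ ∈ S, ∀ q ∈ S, sqNormInt (v₀ - q) = N → ∀ q' ∈ S,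
    (sqNormInt (v₀ - q') = N ∧ q ≠ q' ∧ sqNormInt (q - q') ≠ N) → ∀ r ∈ S, (sqNormInt (v₀ - r) = N ∧
    sqNormInt (q - r) = N ∧ sqNormInt (q' - r) = N) → 3 * sqNormInt (q - q') = 8 * N) ∧ (∀ v₀ ∈ S, ∀
    q ∈ S, sqNormInt (v₀ - q) = N → ∀ q' ∈ S, (sqNormInt (v₀ - q') = N ∧ q ≠ q' ∧ sqNormInt (q - q')
    ≠ N) → ∀ r₁ ∈ S, (sqNormInt (v₀ - r₁) = N ∧ sqNormInt (q' - r₁) = N ∧ sqNormInt (q - r₁) ≠ N) →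
    ∀ r₂ ∈ S, (sqNormInt (v₀ - r₂) = N ∧ r₂ ≠ q ∧ r₂ ≠ q' ∧ sqNormInt (q - r₂) ≠ N ∧ sqNormInt (q' -
    r₂) ≠ N ∧ sqNormInt (r₁ - r₂) = N) → sqNormInt (q - q') = 2 * N) ∧ (∀ v₀ ∈ S, ∀ q ∈ S, sqNormInt
    (v₀ - q) = N → ∀ q' ∈ S, (sqNormInt (v₀ - q') = N ∧ q ≠ q' ∧ sqNormInt (q - q') ≠ N) → ∀ r₁ ∈ S,
    (sqNormInt (v₀ - r₁) = N ∧ sqNormInt (q' - r₁) = N ∧ sqNormInt (q - r₁) ≠ N) → ∀ r₂ ∈ S,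
    (sqNormInt (v₀ - r₂) = N ∧ r₁ ≠ r₂ ∧ sqNormInt (q' - r₂) = N ∧ sqNormInt (q - r₂) ≠ N) →
    sqNormInt (q - q') = 3 * N) ∧ (∀ v₀ ∈ S, ∀ q ∈ S, sqNormInt (v₀ - q) = N → ∀ q' ∈ S, (sqNormInt
    (v₀ - q') = N ∧ q ≠ q' ∧ sqNormInt (q - q') ≠ N) → ∀ r₁ ∈ S, (sqNormInt (v₀ - r₁) = N ∧
    sqNormInt (q - r₁) = N ∧ sqNormInt (q' - r₁) ≠ N) → ∀ r₂ ∈ S, (sqNormInt (v₀ - r₂) = N ∧ r₁ ≠ r₂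
    ∧ sqNormInt (q' - r₂) = N ∧ sqNormInt (r₁ - r₂) ≠ N ∧ sqNormInt (q - r₂) ≠ N) → (q - r₁ = q' -
    r₂ ∧ sqNormInt (q - q') = 2 * N) ∨ (q - r₁ = r₂ - q' ∧ sqNormInt (q - q') = 3 * N)) := by
  intro P hP
  rcases hP with rfl | rfl
  · exact ⟨fccInt, 2, two_ne_zero, sqNormInt_fccInt, rfl, fccInt_star_edge, fccInt_star_cases,
      fccInt_star_alpha, fccInt_star_beta, fccInt_star_gamma, fccInt_star_delta⟩
  · exact ⟨hcpInt, 18, by norm_num, sqNormInt_hcpInt, rfl, hcpInt_star_edge, hcpInt_star_cases,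
      hcpInt_star_alpha, hcpInt_star_beta, hcpInt_star_gamma, hcpInt_star_delta⟩

end Summit.AtomisticToContinuum.Crystallization.Theorems
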